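import Summits.Ventures.LatticeQCDFlow.Scaling.UrnProductCertificate
import Summits.Ventures.LatticeQCDFlow.Scaling.StarCycleCertificateLaw

/-!
HONEST FRAMING: exact (Metropolis-corrected) sampling algorithms for lattice gauge theory; figures
of merit are autocorrelation/cost numbers at stated couplings and volumes; no continuum-physics
claim.

# UrnCompositionChainKernel — THE URN COMPOSITION CHAIN AS A MARKOV KERNEL ON THE COMPOSITIONS OF `K + 1` PARTICLES, AND THE OPTIMAL-DELETION ∕ SHARED-INSERTION
# COUPLING AS A MARKOVIAN COUPLING OF IT (lean-2 GEN-35, ours)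

Venture-side (OURS).  Cell `lqcd-flow` (pub-lqcd), unit `pub-lqcd-lean-2-g35`, 2026-08-29.  Chapter V (composition variables), file 7a: the plumbing for the Markov-chain form of
file 6 (`UrnProductCertificate`), completed in file 7b (`UrnCompositionChainLaw`).  THE CHAIN (the `τ = ∞` caricature of the refresh cycle of the homogeneous `q`-content star,
`lean-2/MEMO-gen34` §7, `MEMO-gen35` §2): a finite state space `X` in bijection (`comp`, hypotheses `hinj`, `hsurj`) with the compositions `N : S → ℕ` of `K + 1` particles; one
step deletes a particle of content `a` with probability `u_x(a) = (N(a)/W(a))/Z_x` and inserts a fresh `μ_0`-particle: `P(x,x') = Σ_{a,z} u_x(a)μ_0(z)·𝟙{comp x' + δ_a = comp x + δ_z}`.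
THE COUPLING: the two deletions coupled optimally (LPW Prop. 4.7, tree), the insertion shared: `Q((x,y),(x',y')) = Σ_{a,b,z} q_{xy}(a,b)μ_0(z)𝟙{…x…}𝟙{…y…}`.  Hypothesis-equations
`hP`, `hQ`; no definitions.

## What is proved

* §1 `urnChain_geometric` (`Q ≥ 0`, `Q·Ψ ≤ (1−ρ)Ψ ⇒ Qⁿ·Ψ ≤ (1−ρ)ⁿΨ`), `urnChain_pow_mono`, `sum5_reorder`, `sum4_reorder`.
* §2 `urnChain_sum_single`, `urnChain_survivor`, **`urnChain_target_unique`** (`Σ_{x'} 𝟙{comp x' + δ_a = comp x + δ_z}·g(comp x') = g(M^a + δ_z)`), `urnChain_u_ne_zero`, `urnChain_Z_pos`,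
  `urnChain_support`, `urn_p_le_one`, **`urnChain_isRowStochastic`** (`P` is a stochastic matrix), **`urnChain_isMarkovianCoupling`** (`Q` is a Markovian coupling of `P`).

NOT CLAIMED: anything measured.  Literature grade (cell rule): OWN, elementary on the tree's LPW files; nothing cited as a fact; no new bib keys.
-/


open Finset Matrix
open Literature.Probability.MarkovChains

namespace Summit.Ventures.LatticeQCDFlow.Scaling

/-! ## §1 Generic lemmas -/

section Generic
variable {Z : Type*} [Fintype Z] [DecidableEq Z] {Q : Matrix Z Z ℝ} {Ψ : Z → ℝ} {ρ : ℝ}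

/-- `Q ≥ 0`, `Q·Ψ ≤ (1−ρ)·Ψ`, `ρ ≤ 1 ⇒ Qⁿ·Ψ ≤ (1−ρ)ⁿ·Ψ`. [ours] -/
theorem urnChain_geometric (hQ0 : ∀ z z', 0 ≤ Q z z') (hρ1 : ρ ≤ 1) (hcontr : ∀ z, (Q *ᵥ Ψ) z ≤ (1 - ρ) * Ψ z) (n : ℕ) (z : Z) :
    ((Q ^ n) *ᵥ Ψ) z ≤ (1 - ρ) ^ n * Ψ z := by
  induction n generalizing z with
  | zero => rw [pow_zero, Matrix.one_mulVec, pow_zero, one_mul]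
  | succ n ih =>
    rw [pow_succ', ← Matrix.mulVec_mulVec]
    have h1 : (Q *ᵥ ((Q ^ n) *ᵥ Ψ)) z ≤ (Q *ᵥ ((1 - ρ) ^ n • Ψ)) z :=
      cyc_mulVec_mono hQ0 (fun z' => by rw [Pi.smul_apply, smul_eq_mul]; exact ih z') z
    rw [Matrix.mulVec_smul, Pi.smul_apply, smul_eq_mul] at h1
    calc (Q *ᵥ ((Q ^ n) *ᵥ Ψ)) z ≤ (1 - ρ) ^ n * (Q *ᵥ Ψ) z := h1
      _ ≤ (1 - ρ) ^ n * ((1 - ρ) * Ψ z) := mul_le_mul_of_nonneg_left (hcontr z) (pow_nonneg (by linarith) n)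
      _ = (1 - ρ) ^ (n + 1) * Ψ z := by ring

/-- `Q ≥ 0`, `f ≤ g ⇒ Qⁿ·f ≤ Qⁿ·g`. [ours] -/
theorem urnChain_pow_mono (hQ0 : ∀ z z', 0 ≤ Q z z') {f g : Z → ℝ} (hfg : ∀ z, f z ≤ g z) (n : ℕ) (z : Z) :
    ((Q ^ n) *ᵥ f) z ≤ ((Q ^ n) *ᵥ g) z := by
  induction n generalizing z with
  | zero => rw [pow_zero, Matrix.one_mulVec, Matrix.one_mulVec]; exact hfg z
  | succ n ih =>
    rw [pow_succ', ← Matrix.mulVec_mulVec, ← Matrix.mulVec_mulVec]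
    exact cyc_mulVec_mono hQ0 ih z

end Generic

section Reorder
variable {A B C D E : Type*} [Fintype A] [Fintype B] [Fintype C] [Fintype D] [Fintype E]

/-- Reordering of a fivefold sum: `Σ_{d,e} Σ_{a,b,c} = Σ_{a,b,c} Σ_{d,e}`. [ours] -/
theorem sum5_reorder (f : A → B → C → D → E → ℝ) :
    ∑ d, ∑ e, ∑ a, ∑ b, ∑ c, f a b c d e = ∑ a, ∑ b, ∑ c, ∑ d, ∑ e, f a b c d e := by
  calc ∑ d, ∑ e, ∑ a, ∑ b, ∑ c, f a b c d e = ∑ d, ∑ a, ∑ e, ∑ b, ∑ c, f a b c d e := sum_congr rfl fun d _ => Finset.sum_comm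
    _ = ∑ a, ∑ d, ∑ e, ∑ b, ∑ c, f a b c d e := Finset.sum_comm
    _ = ∑ a, ∑ d, ∑ b, ∑ e, ∑ c, f a b c d e := sum_congr rfl fun a _ => sum_congr rfl fun d _ => Finset.sum_comm
    _ = ∑ a, ∑ b, ∑ d, ∑ e, ∑ c, f a b c d e := sum_congr rfl fun a _ => Finset.sum_comm
    _ = ∑ a, ∑ b, ∑ d, ∑ c, ∑ e, f a b c d e :=
        sum_congr rfl fun a _ => sum_congr rfl fun b _ => sum_congr rfl fun d _ => Finset.sum_comm
    _ = ∑ a, ∑ b, ∑ c, ∑ d, ∑ e, f a b c d e := sum_congr rfl fun a _ => sum_congr rfl fun b _ => Finset.sum_comm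

/-- Reordering of a fourfold sum: `Σ_d Σ_{a,b,c} = Σ_{a,b,c} Σ_d`. [ours] -/
theorem sum4_reorder (f : A → B → C → D → ℝ) :
    ∑ d, ∑ a, ∑ b, ∑ c, f a b c d = ∑ a, ∑ b, ∑ c, ∑ d, f a b c d := by
  calc ∑ d, ∑ a, ∑ b, ∑ c, f a b c d = ∑ a, ∑ d, ∑ b, ∑ c, f a b c d := Finset.sum_comm
    _ = ∑ a, ∑ b, ∑ d, ∑ c, f a b c d := sum_congr rfl fun a _ => Finset.sum_comm
    _ = ∑ a, ∑ b, ∑ c, ∑ d, f a b c d := sum_congr rfl fun a _ => sum_congr rfl fun b _ => Finset.sum_comm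

end Reorder

section UrnChain
variable {X : Type*} [Fintype X] [DecidableEq X] {S : Type*} [Fintype S] [DecidableEq S]
variable {comp : X → S → ℕ} {K : ℕ} {W θ μ0 : S → ℝ} {p : ℝ} {Zc : X → ℝ} {u : X → S → ℝ}
variable {P : X → X → ℝ} {Q : Matrix (X × X) (X × X) ℝ} {Δ : (S → ℕ) → (S → ℕ) → ℕ} {Ψ : X × X → ℝ}

/-! ## §2 Bookkeeping on the composition state space -/

omit [DecidableEq X] [Fintype X] in
/-- `Σ_v (M + δ_z)(v) = Σ_v M(v) + 1`. [ours] -/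
theorem urnChain_sum_single (M : S → ℕ) (z : S) : ∑ v, (M + Pi.single z 1 : S → ℕ) v = ∑ v, M v + 1 := by
  simp only [Pi.add_apply]
  rw [sum_add_distrib, Finset.sum_pi_single']
  simp

omit [Fintype X] [DecidableEq X] [Fintype S] in
/-- The survivors: if `N(a) ≠ 0` then `N = (N − δ_a) + δ_a` (truncated subtraction, pointwise). [ours] -/
theorem urnChain_survivor (N : S → ℕ) {a : S} (ha : N a ≠ 0) : N = (N - Pi.single a 1) + Pi.single a 1 := by
  funext v
  simp only [Pi.add_apply, Pi.sub_apply, Pi.single_apply]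
  split_ifs with h
  · subst h; omega
  · omega

omit [DecidableEq X] in
/-- **The target of a move is unique:** if `comp x = M + δ_a` then `Σ_{x'} 𝟙{comp x' + δ_a = comp x + δ_z}·g(comp x') = g(M + δ_z)` (`comp` injective onto the
compositions of `K + 1` particles). [ours] -/
theorem urnChain_target_unique (hinj : Function.Injective comp) (hsum : ∀ x, ∑ v, comp x v = K + 1)
    (hsurj : ∀ N : S → ℕ, ∑ v, N v = K + 1 → ∃ x, comp x = N) {x : X} {M : S → ℕ} {a : S} (hM : comp x = M + Pi.single a 1) (z : S)
    (g : (S → ℕ) → ℝ) :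
    ∑ x', (if comp x' + Pi.single a 1 = comp x + Pi.single z 1 then g (comp x') else 0) = g (M + Pi.single z 1) := by
  have hK : ∑ v, M v = K := by
    have h := hsum x; rw [hM, urnChain_sum_single] at h; omega
  have hT : ∑ v, (M + Pi.single z 1 : S → ℕ) v = K + 1 := by rw [urnChain_sum_single, hK]
  obtain ⟨x0, hx0⟩ := hsurj _ hT
  have hiff : ∀ x', comp x' + Pi.single a 1 = comp x + Pi.single z 1 ↔ comp x' = M + Pi.single z 1 := by
    intro x'
    rw [hM, show (M + Pi.single a 1 + Pi.single z 1 : S → ℕ) = (M + Pi.single z 1) + Pi.single a 1 by abel]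
    exact ⟨fun h => add_right_cancel h, fun h => by rw [h]⟩
  simp_rw [hiff]
  rw [Finset.sum_eq_single x0]
  · rw [if_pos hx0, hx0]
  · intro x' _ hx'
    rw [if_neg]
    intro h; exact hx' (hinj (h.trans hx0.symm))
  · intro h; exact absurd (mem_univ x0) h

omit [Fintype X] [DecidableEq X] [Fintype S] [DecidableEq S] in
/-- `u_x(a) ≠ 0 ⇒ comp x (a) ≠ 0` for the urn law. [ours] -/
theorem urnChain_u_ne_zero (hu : ∀ x v, u x v = (comp x v : ℝ) / W v / Zc x) {x : X} {a : S} (h : u x a ≠ 0) : comp x a ≠ 0 := by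
  intro h0; apply h; rw [hu, h0, Nat.cast_zero, zero_div, zero_div]

omit [Fintype X] [DecidableEq X] [DecidableEq S] in
/-- `Z_x > 0`. [ours] -/
theorem urnChain_Z_pos (hsum : ∀ x, ∑ v, comp x v = K + 1) (hW : ∀ v, 0 < W v) (hZ : ∀ x, Zc x = ∑ v, (comp x v : ℝ) / W v) (x : X) : 0 < Zc x := by
  refine urn_Z_pos hW (hZ x) ?_
  by_contra h
  have h' : ∀ v, comp x v = 0 := fun v => by
    by_contra hv; exact h ⟨v, hv⟩
  have : ∑ v, comp x v = 0 := sum_eq_zero fun v _ => h' v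
  rw [hsum x] at this; omega

omit [DecidableEq S] in
/-- On the support of a coupling of `(u_x, u_y)` both deletions are legal: `q(a,b) ≠ 0 ⇒ u_x(a) ≠ 0 ∧ u_y(b) ≠ 0`. [ours] -/
theorem urnChain_support {ux uy : S → ℝ} {q : S → S → ℝ} (hq : IsCoupling ux uy q) {a b : S} (h : q a b ≠ 0) : ux a ≠ 0 ∧ uy b ≠ 0 := by
  constructor
  · intro h0
    have : q a b ≤ ux a := by
      rw [← hq.2.1 a]; exact single_le_sum (f := fun b' => q a b') (fun b' _ => hq.1 a b') (mem_univ b)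
    rw [h0] at this; exact h (le_antisymm this (hq.1 a b))
  · intro h0
    have : q a b ≤ uy b := by
      rw [← hq.2.2 b]; exact single_le_sum (f := fun a' => q a' b) (fun a' _ => hq.1 a' b) (mem_univ a)
    rw [h0] at this; exact h (le_antisymm this (hq.1 a b))

omit [DecidableEq X] in
/-- **`P` is a stochastic matrix.** [ours] -/
theorem urnChain_isRowStochastic (hinj : Function.Injective comp) (hsum : ∀ x, ∑ v, comp x v = K + 1)
    (hsurj : ∀ N : S → ℕ, ∑ v, N v = K + 1 → ∃ x, comp x = N) (hW : ∀ v, 0 < W v) (hμ0 : ∀ v, 0 ≤ μ0 v) (hμ1 : ∑ v, μ0 v = 1)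
    (hZ : ∀ x, Zc x = ∑ v, (comp x v : ℝ) / W v) (hu : ∀ x v, u x v = (comp x v : ℝ) / W v / Zc x)
    (hP : ∀ x x', P x x' = ∑ a, ∑ z, u x a * μ0 z * (if comp x' + Pi.single a 1 = comp x + Pi.single z 1 then (1 : ℝ) else 0)) :
    IsRowStochastic P := by
  have hZ0 := urnChain_Z_pos hsum hW hZ
  refine ⟨fun x x' => ?_, fun x => ?_⟩
  · rw [hP]
    exact sum_nonneg fun a _ => sum_nonneg fun z _ => mul_nonneg (mul_nonneg (urn_law_nonneg hW (hZ0 x) (hu x) a) (hμ0 z)) (by split_ifs <;> norm_num)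
  · simp_rw [hP]
    -- `Σ_{x'} Σ_a Σ_z = Σ_a Σ_z Σ_{x'}`
    rw [Finset.sum_comm]
    have hinner : ∀ a, ∑ x', ∑ z, u x a * μ0 z * (if comp x' + Pi.single a 1 = comp x + Pi.single z 1 then (1 : ℝ) else 0) = u x a := by
      intro a
      rw [Finset.sum_comm]
      by_cases hua : u x a = 0
      · simp [hua]
      · have hM := urnChain_survivor (comp x) (urnChain_u_ne_zero hu hua)
        have h1 : ∀ z, ∑ x', u x a * μ0 z * (if comp x' + Pi.single a 1 = comp x + Pi.single z 1 then (1 : ℝ) else 0) = u x a * μ0 z := by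
          intro z
          have h := urnChain_target_unique hinj hsum hsurj hM z (fun _ => (1 : ℝ))
          rw [← Finset.mul_sum, h, mul_one]
        simp_rw [h1]
        rw [← Finset.mul_sum, hμ1, mul_one]
    simp_rw [hinner]
    exact urn_law_sum_eq_one (hZ x) (hZ0 x) (hu x)

omit [DecidableEq X] in
/-- **`Q` is a Markovian coupling of `P` with itself** (optimal coupling of the deletions, shared insertion). [ours] -/
theorem urnChain_isMarkovianCoupling (hinj : Function.Injective comp) (hsum : ∀ x, ∑ v, comp x v = K + 1)
    (hsurj : ∀ N : S → ℕ, ∑ v, N v = K + 1 → ∃ x, comp x = N) (hW : ∀ v, 0 < W v) (hμ0 : ∀ v, 0 ≤ μ0 v)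
    (hZ : ∀ x, Zc x = ∑ v, (comp x v : ℝ) / W v) (hu : ∀ x v, u x v = (comp x v : ℝ) / W v / Zc x)
    (hP : ∀ x x', P x x' = ∑ a, ∑ z, u x a * μ0 z * (if comp x' + Pi.single a 1 = comp x + Pi.single z 1 then (1 : ℝ) else 0))
    (hQ : ∀ x y x' y', Q (x, y) (x', y') = ∑ a, ∑ b, ∑ z, optimalCoupling (u x) (u y) a b * μ0 z
      * (if comp x' + Pi.single a 1 = comp x + Pi.single z 1 then (1 : ℝ) else 0) * (if comp y' + Pi.single b 1 = comp y + Pi.single z 1 then (1 : ℝ) else 0)) :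
    IsMarkovianCoupling P Q := by
  have hZ0 := urnChain_Z_pos hsum hW hZ
  intro x y
  have hq := optimalCoupling_isCoupling (urn_law_nonneg hW (hZ0 x) (hu x)) (urn_law_nonneg hW (hZ0 y) (hu y)) (urn_law_sum_eq_one (hZ x) (hZ0 x) (hu x))
    (urn_law_sum_eq_one (hZ y) (hZ0 y) (hu y))
  refine ⟨fun x' y' => ?_, fun x' => ?_, fun y' => ?_⟩
  · show 0 ≤ Q (x, y) (x', y')
    rw [hQ]
    exact sum_nonneg fun a _ => sum_nonneg fun b _ => sum_nonneg fun z _ =>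
      mul_nonneg (mul_nonneg (mul_nonneg (hq.1 a b) (hμ0 z)) (by split_ifs <;> norm_num)) (by split_ifs <;> norm_num)
  · -- first marginal: sum over `y'`
    show ∑ y', Q (x, y) (x', y') = P x x'
    simp_rw [hQ]
    rw [sum4_reorder, hP]
    refine sum_congr rfl fun a _ => ?_
    -- `Σ_b Σ_z Σ_{y'} … = Σ_z u_x(a) μ0(z) 𝟙{x-cond}`
    have hb : ∀ b z, ∑ y', optimalCoupling (u x) (u y) a b * μ0 z
        * (if comp x' + Pi.single a 1 = comp x + Pi.single z 1 then (1 : ℝ) else 0) * (if comp y' + Pi.single b 1 = comp y + Pi.single z 1 then (1 : ℝ) else 0)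
        = optimalCoupling (u x) (u y) a b * μ0 z * (if comp x' + Pi.single a 1 = comp x + Pi.single z 1 then (1 : ℝ) else 0) := by
      intro b z
      by_cases hqz : optimalCoupling (u x) (u y) a b = 0
      · simp [hqz]
      · have hM := urnChain_survivor (comp y) (urnChain_u_ne_zero hu (urnChain_support hq hqz).2)
        have h := urnChain_target_unique hinj hsum hsurj hM z (fun _ => (1 : ℝ))
        rw [← Finset.mul_sum, h, mul_one]
    simp_rw [hb]
    rw [Finset.sum_comm]
    refine sum_congr rfl fun z _ => ?_
    rw [← Finset.sum_mul, ← Finset.sum_mul, hq.2.1 a]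
  · -- second marginal: sum over `x'`
    show ∑ x', Q (x, y) (x', y') = P y y'
    simp_rw [hQ]
    rw [sum4_reorder, hP, Finset.sum_comm]
    refine sum_congr rfl fun b _ => ?_
    have ha : ∀ a z, ∑ x', optimalCoupling (u x) (u y) a b * μ0 z
        * (if comp x' + Pi.single a 1 = comp x + Pi.single z 1 then (1 : ℝ) else 0) * (if comp y' + Pi.single b 1 = comp y + Pi.single z 1 then (1 : ℝ) else 0)
        = optimalCoupling (u x) (u y) a b * μ0 z * (if comp y' + Pi.single b 1 = comp y + Pi.single z 1 then (1 : ℝ) else 0) := by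
      intro a z
      by_cases hqz : optimalCoupling (u x) (u y) a b = 0
      · simp [hqz]
      · have hM := urnChain_survivor (comp x) (urnChain_u_ne_zero hu (urnChain_support hq hqz).1)
        have h := urnChain_target_unique hinj hsum hsurj hM z (fun _ => (1 : ℝ))
        have hrw : ∀ x', optimalCoupling (u x) (u y) a b * μ0 z * (if comp x' + Pi.single a 1 = comp x + Pi.single z 1 then (1 : ℝ) else 0)
            * (if comp y' + Pi.single b 1 = comp y + Pi.single z 1 then (1 : ℝ) else 0)
            = (optimalCoupling (u x) (u y) a b * μ0 z * (if comp y' + Pi.single b 1 = comp y + Pi.single z 1 then (1 : ℝ) else 0))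
              * (if comp x' + Pi.single a 1 = comp x + Pi.single z 1 then (1 : ℝ) else 0) := fun x' => by ring
        simp_rw [hrw]
        rw [← Finset.mul_sum, h, mul_one]
    simp_rw [ha]
    rw [Finset.sum_comm]
    refine sum_congr rfl fun z _ => ?_
    rw [← Finset.sum_mul, ← Finset.sum_mul, hq.2.2 b]

omit [Fintype X] [DecidableEq X] [DecidableEq S] in
/-- `p ≤ 1` for the urn's data (`Σ μ_0 = 1`, `Σ μ_0 W = 1`, `p·W ≤ 1`, `μ_0 ≥ 0`). [ours] -/
theorem urn_p_le_one (hp : ∀ v, p * W v ≤ 1) (hμ0 : ∀ v, 0 ≤ μ0 v) (hμ1 : ∑ v, μ0 v = 1) (hμW : ∑ v, μ0 v * W v = 1) : p ≤ 1 := by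
  calc p = p * ∑ v, μ0 v * W v := by rw [hμW, mul_one]
    _ = ∑ v, μ0 v * (p * W v) := by rw [mul_sum]; exact sum_congr rfl fun v _ => by ring
    _ ≤ ∑ v, μ0 v * 1 := sum_le_sum fun v _ => mul_le_mul_of_nonneg_left (hp v) (hμ0 v)
    _ = 1 := by rw [← sum_mul, hμ1, one_mul]

end UrnChain

end Summit.Ventures.LatticeQCDFlow.Scaling
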